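import Summits.Ventures.PercRepro.Night2T3Corank5

/-!
# PercRepro — the type-`3` balance when every plane has `≤ 4` points: coranks `6` and `7` (night-2, NIGHT-2-t3.md §7.2)

Hypothesis `hP : ∀ X ⊆ G, M.eRk X ≤ 3 → #X ≤ 4` («every plane of `G` has at most `4` points»).  Then a rank-`≤ 2`
subset of `G` has `≤ 3` points (a point of `G` outside its closure lifts it to a rank-`3` set), so the cyclic part of a
rank-`q` subset `S` with `|S| ≥ q + 2` has rank `≥ 4`: `m(S) + 4 ≤ q` (`mTr_add_four_le_of_planes`).  The lower
degree bound sharpens to `(d − j + 4)·#C_j ≤ (j + 1)·#C_{j+1}` for `j + 2 ≤ d` (`succ_mul_card_ge_of_planes`), and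
the corank-`6` and corank-`7` cases of the balance follow by the bookkeeping of Theorem C.  Imports `Night2T3Corank5` only.
-/
namespace PercRepro.Star

open Finset ThmH SixFour GenQ

variable {α : Type*} [DecidableEq α] {M : Matroid α} [M.Finite]

omit [M.Finite] in
/-- If every rank-`≤ 3` subset of `G` has `≤ 4` points and `G` has rank `q ≥ 4`, then every rank-`≤ 2` subset of `G`
has `≤ 3` points. -/
theorem card_le_three_of_eRk_le_two {G : Finset α} {q : ℕ} (hrG : M.eRk (G : Set α) = (q : ℕ∞)) (hq : 4 ≤ q)
    (hP : ∀ X ⊆ G, M.eRk (X : Set α) ≤ 3 → X.card ≤ 4) {X : Finset α} (hX : X ⊆ G)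
    (h2 : M.eRk (X : Set α) ≤ 2) : X.card ≤ 3 := by
  by_contra hlt
  push Not at hlt
  have hlt' : M.eRk (X : Set α) < M.eRk (G : Set α) := by
    rw [hrG]
    calc M.eRk (X : Set α) ≤ 2 := h2
      _ < 4 := by norm_num
      _ ≤ (q : ℕ∞) := by exact_mod_cast hq
  obtain ⟨y, hy, hy'⟩ := Matroid.exists_eRk_insert_eq_add_one_of_lt hlt'
  have hyG : y ∈ G := (Set.mem_sdiff y).1 hy |>.1
  have hyX : y ∉ X := fun h => ((Set.mem_sdiff y).1 hy).2 (Finset.mem_coe.2 h)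
  have hsub : insert y X ⊆ G := Finset.insert_subset hyG hX
  have hr3 : M.eRk ((insert y X : Finset α) : Set α) ≤ 3 := by
    rw [Finset.coe_insert, hy']
    calc M.eRk (X : Set α) + 1 ≤ 2 + 1 := by gcongr
      _ = 3 := by norm_num
  have := hP _ hsub hr3
  rw [Finset.card_insert_of_notMem hyX] at this
  omega

/-- Under the plane bound, on a simple matroid a rank-`q` subset `S ⊆ G` with `q + 2 ≤ |S|` has at most `q − 4`
coloops: its cyclic part has rank `≥ 4`. -/
theorem mTr_add_four_le_of_planes (hs : Simple M) {G : Finset α} {q : ℕ} (hG : G ⊆ gr M)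
    (hrG : M.eRk (G : Set α) = (q : ℕ∞)) (hq : 4 ≤ q)
    (hP : ∀ X ⊆ G, M.eRk (X : Set α) ≤ 3 → X.card ≤ 4) {S : Finset α} (hS : S ⊆ G)
    (hr : M.eRk (S : Set α) = (q : ℕ∞)) (hcard : q + 2 ≤ S.card) : mTr M S + 4 ≤ q := by
  set C := coloopsOf M S with hC
  have hCS : C ⊆ S := coloopsOf_subset S
  have hm : mTr M S = C.card := rfl
  have hlt : q < S.card := by omega
  have hm2 := mTr_add_two_le_of_spanning_nonbasis hs (hS.trans hG) hr (by omega) hlt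
  have hsum := eRk_sdiff_add_card_eq_of_subset_coloopsOf (hS.trans hG) C (Finset.Subset.refl _)
  rw [hr] at hsum
  obtain ⟨r, hr'⟩ := exists_eRk_eq_nat (M := M) (S \ C)
  rw [hr'] at hsum
  have hrm : r + C.card = q := by exact_mod_cast hsum
  have hcardS : S.card = (S \ C).card + C.card := by
    rw [Finset.card_sdiff_of_subset hCS]
    have := Finset.card_le_card hCS
    omega
  have hZG : S \ C ⊆ G := (Finset.sdiff_subset).trans hS
  by_contra hlt4
  push Not at hlt4
  -- the cyclic part has rank `r ≤ 3`
  have hr3 : r ≤ 3 := by omega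
  rcases Nat.lt_or_ge r 3 with h2 | h3
  · -- rank `≤ 2`: at most `3` points
    have hle : M.eRk ((S \ C : Finset α) : Set α) ≤ 2 := by
      rw [hr']
      exact_mod_cast (by omega : r ≤ 2)
    have := card_le_three_of_eRk_le_two hrG hq hP hZG hle
    omega
  · -- rank `3`: at most `4` points
    have hle : M.eRk ((S \ C : Finset α) : Set α) ≤ 3 := by
      rw [hr']
      exact_mod_cast hr3
    have := hP _ hZG hle
    omega

/-- **The sharpened lower degree bound** under the plane bound: `(d − j + 4)·#C_j ≤ (j + 1)·#C_{j+1}` for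
`j + 2 ≤ d`. -/
theorem succ_mul_card_ge_of_planes (hs : Simple M) {G : Finset α} {q : ℕ} (hG : G ⊆ gr M)
    (hrG : M.eRk (G : Set α) = (q : ℕ∞)) (hq : 4 ≤ q)
    (hP : ∀ X ⊆ G, M.eRk (X : Set α) ≤ 3 → X.card ≤ 4) {j : ℕ} (hj : j + 2 ≤ G.card - q) :
    (G.card - q - j + 4) * ((Rq M G q).filter (fun S : Finset α => (G \ S).card = j)).card ≤
      (j + 1) * ((Rq M G q).filter (fun S : Finset α => (G \ S).card = j + 1)).card := by
  rw [← sum_card_sub_mTr_eq_succ_mul_card hG hrG j, mul_comm, Finset.card_eq_sum_ones, Finset.sum_mul]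
  apply Finset.sum_le_sum
  intro S hS
  rw [Finset.mem_filter] at hS
  have hS' := mem_Rq.1 hS.1
  have hsd := Finset.card_sdiff_of_subset hS'.1
  have hle := Finset.card_le_card hS'.1
  have hSq : q ≤ S.card := le_card_of_eRk_eq hS'.2
  have hcard : q + 2 ≤ S.card := by omega
  have hm := mTr_add_four_le_of_planes hs hG hrG hq hP hS'.1 hS'.2 hcard
  rw [one_mul]
  omega

/-- The common preamble of the corank-`6` / `7` cases: the size form split by `|G ∖ S|`, with `#C_0 = 1` and
`#C_0 + #C_1 + #C_2 ≤ DF_3`.  Stated as the inequality to prove after the split. -/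
theorem Jq_three_nonneg_of_split (hs : Simple M) {G : Finset α} {q d : ℕ} (hG : G ⊆ gr M)
    (hrG : M.eRk (G : Set α) = (q : ℕ∞)) (hq : 1 ≤ q) (hcard : G.card = q + d)
    (h : 0 ≤ ((q : ℚ) + 2) * ((((Rq M G q).filter (fun S : Finset α => (G \ S).card ≤ 2)).card : ℕ) : ℚ) +
      ∑ j ∈ Finset.range (d + 1),
        ((((Rq M G q).filter (fun S : Finset α => (G \ S).card = j)).card : ℕ) : ℚ) * (2 * (j : ℚ) - (d : ℚ) - 3)) :
    0 ≤ Jq M G q 3 := by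
  apply Jq_three_nonneg_of_sizes hs hG hrG hq
  have hjd : ∀ S ∈ Rq M G q, (G \ S).card ≤ d := by
    intro S hS
    have hS' := mem_Rq.1 hS
    have hSq : q ≤ S.card := le_card_of_eRk_eq hS'.2
    rw [Finset.card_sdiff_of_subset hS'.1]
    omega
  have hterm : ∀ S ∈ Rq M G q,
      ((G.card : ℚ) + (q : ℚ) - 3 - 2 * (S.card : ℚ)) = 2 * ((G \ S).card : ℚ) - (d : ℚ) - 3 := by
    intro S hS
    have hS' := mem_Rq.1 hS
    have hsd := Finset.card_sdiff_of_subset hS'.1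
    have hle := Finset.card_le_card hS'.1
    have : ((G \ S).card : ℚ) = (G.card : ℚ) - (S.card : ℚ) := by
      rw [hsd]
      push_cast [hle]
      ring
    rw [this, hcard]
    push_cast
    ring
  rw [Finset.sum_congr rfl hterm]
  have hsplit : ∑ S ∈ Rq M G q, (2 * ((G \ S).card : ℚ) - (d : ℚ) - 3) =
      ∑ j ∈ Finset.range (d + 1),
        ((((Rq M G q).filter (fun S : Finset α => (G \ S).card = j)).card : ℕ) : ℚ) * (2 * (j : ℚ) - (d : ℚ) - 3) := by
    rw [← Finset.sum_fiberwise_of_maps_to (s := Rq M G q) (t := Finset.range (d + 1))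
      (g := fun S : Finset α => (G \ S).card) (fun S hS => Finset.mem_range.2 (by have := hjd S hS; omega))]
    apply Finset.sum_congr rfl
    intro j _
    rw [Finset.sum_congr rfl (fun S hS => by
      rw [(Finset.mem_filter.1 hS).2]), Finset.sum_const, nsmul_eq_mul]
  rw [hsplit]
  have hDF := card_filter_sdiff_le_two_le_DFq (M := M) (G := G) (q := q)
  have hDF' : ((((Rq M G q).filter (fun S : Finset α => (G \ S).card ≤ 2)).card : ℕ) : ℚ) ≤ (DFq M G q 3 : ℚ) := by
    exact_mod_cast hDF
  have hq2 : (0 : ℚ) ≤ (q : ℚ) + 2 := by positivity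
  have := mul_le_mul_of_nonneg_left hDF' hq2
  linarith

/-- `#C_0 = 1` on a rank-`q` set. -/
theorem card_filter_sdiff_eq_zero {G : Finset α} {q : ℕ} (hrG : M.eRk (G : Set α) = (q : ℕ∞)) :
    ((Rq M G q).filter (fun S : Finset α => (G \ S).card = 0)).card = 1 := by
  have : (Rq M G q).filter (fun S : Finset α => (G \ S).card = 0) = {G} := by
    ext S
    simp only [Finset.mem_filter, mem_Rq, Finset.mem_singleton, Finset.card_eq_zero,
      Finset.sdiff_eq_empty_iff_subset]
    constructor
    · rintro ⟨⟨hSG, -⟩, hGS⟩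
      exact Finset.Subset.antisymm hSG hGS
    · rintro rfl
      exact ⟨⟨Finset.Subset.refl _, hrG⟩, Finset.Subset.refl _⟩
  rw [this, Finset.card_singleton]

/-- `#C_0 + #C_1 + #C_2 ≤ #{S : |G ∖ S| ≤ 2}`. -/
theorem card_three_le_card_filter_le_two (G : Finset α) (q : ℕ) :
    ((Rq M G q).filter (fun S : Finset α => (G \ S).card = 0)).card +
      ((Rq M G q).filter (fun S : Finset α => (G \ S).card = 1)).card +
      ((Rq M G q).filter (fun S : Finset α => (G \ S).card = 2)).card ≤
      ((Rq M G q).filter (fun S : Finset α => (G \ S).card ≤ 2)).card := by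
  have h01 : Disjoint ((Rq M G q).filter (fun S : Finset α => (G \ S).card = 0))
      ((Rq M G q).filter (fun S : Finset α => (G \ S).card = 1)) := by
    rw [Finset.disjoint_filter]
    intro S _ h0 h1
    omega
  have h012 : Disjoint ((Rq M G q).filter (fun S : Finset α => (G \ S).card = 0) ∪
      (Rq M G q).filter (fun S : Finset α => (G \ S).card = 1))
      ((Rq M G q).filter (fun S : Finset α => (G \ S).card = 2)) := by
    rw [Finset.disjoint_union_left]
    constructor <;> (rw [Finset.disjoint_filter]; intro S _ h0 h1; omega)
  have hsub : (Rq M G q).filter (fun S : Finset α => (G \ S).card = 0) ∪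
      (Rq M G q).filter (fun S : Finset α => (G \ S).card = 1) ∪
      (Rq M G q).filter (fun S : Finset α => (G \ S).card = 2) ⊆
      (Rq M G q).filter (fun S : Finset α => (G \ S).card ≤ 2) := by
    intro S hS
    simp only [Finset.mem_union, Finset.mem_filter] at hS ⊢
    rcases hS with (⟨h, h'⟩ | ⟨h, h'⟩) | ⟨h, h'⟩ <;> exact ⟨h, by omega⟩
  have := Finset.card_le_card hsub
  rwa [Finset.card_union_of_disjoint h012, Finset.card_union_of_disjoint h01] at this

/-- **Corank `6` under the plane bound**: `0 ≤ J_3(G)` for `4 ≤ q`, `|G| = q + 6`, every plane of `G` with `≤ 4` points. -/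
theorem Jq_three_nonneg_of_card_eq_add_six_of_planes (hs : Simple M) {G : Finset α} {q : ℕ} (hG : G ⊆ gr M)
    (hrG : M.eRk (G : Set α) = (q : ℕ∞)) (hq : 4 ≤ q)
    (hP : ∀ X ⊆ G, M.eRk (X : Set α) ≤ 3 → X.card ≤ 4) (hcard : G.card = q + 6) : 0 ≤ Jq M G q 3 := by
  apply Jq_three_nonneg_of_split hs hG hrG (by omega) hcard
  set C : ℕ → ℕ := fun j => ((Rq M G q).filter (fun S : Finset α => (G \ S).card = j)).card with hC
  have hd : G.card - q = 6 := by omega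
  have hC0 : C 0 = 1 := card_filter_sdiff_eq_zero hrG
  have hle2 := card_three_le_card_filter_le_two (M := M) G q
  have l0 := succ_mul_card_ge_of_planes hs hG hrG hq hP (j := 0) (by omega)
  have l1 := succ_mul_card_ge_of_planes hs hG hrG hq hP (j := 1) (by omega)
  have l2 := succ_mul_card_ge_of_planes hs hG hrG hq hP (j := 2) (by omega)
  have l3 := succ_mul_card_ge_of_planes hs hG hrG hq hP (j := 3) (by omega)
  have l4 := succ_mul_card_ge_of_planes hs hG hrG hq hP (j := 4) (by omega)
  have l5 := succ_mul_card_ge hs hG hrG (by omega) (j := 5) (by omega)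
  rw [hd] at l0 l1 l2 l3 l4 l5
  simp only [Finset.sum_range_succ, Finset.sum_range_zero]
  push_cast
  have hq' : (4 : ℚ) ≤ (q : ℚ) := by exact_mod_cast hq
  have c0 : ((C 0 : ℕ) : ℚ) = 1 := by exact_mod_cast hC0
  have e2 : ((C 0 : ℕ) : ℚ) + (C 1 : ℕ) + (C 2 : ℕ) ≤
      ((((Rq M G q).filter (fun S : Finset α => (G \ S).card ≤ 2)).card : ℕ) : ℚ) := by exact_mod_cast hle2
  have m0 : (10 : ℚ) * (C 0 : ℕ) ≤ (C 1 : ℕ) := by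
    have h' : 10 * C 0 ≤ C 1 := by
      simpa only [Nat.sub_zero, Nat.reduceAdd, Nat.zero_add, Nat.one_mul] using l0
    exact_mod_cast h'
  have m1 : (9 : ℚ) * (C 1 : ℕ) ≤ 2 * (C 2 : ℕ) := by exact_mod_cast (by simpa using l1 : 9 * C 1 ≤ 2 * C 2)
  have m2 : (8 : ℚ) * (C 2 : ℕ) ≤ 3 * (C 3 : ℕ) := by exact_mod_cast (by simpa using l2 : 8 * C 2 ≤ 3 * C 3)
  have m3 : (7 : ℚ) * (C 3 : ℕ) ≤ 4 * (C 4 : ℕ) := by exact_mod_cast (by simpa using l3 : 7 * C 3 ≤ 4 * C 4)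
  have m4 : (6 : ℚ) * (C 4 : ℕ) ≤ 5 * (C 5 : ℕ) := by exact_mod_cast (by simpa using l4 : 6 * C 4 ≤ 5 * C 5)
  have m5 : (3 : ℚ) * (C 5 : ℕ) ≤ 6 * (C 6 : ℕ) := by exact_mod_cast (by simpa using l5 : 3 * C 5 ≤ 6 * C 6)
  have hq2 : (0 : ℚ) ≤ (q : ℚ) + 2 := by positivity
  have e1 := mul_le_mul_of_nonneg_left e2 hq2
  have p1 : 4 * ((C 1 : ℕ) : ℚ) ≤ (q : ℚ) * (C 1 : ℕ) := mul_le_mul_of_nonneg_right hq' (by positivity)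
  have p2 : 4 * ((C 2 : ℕ) : ℚ) ≤ (q : ℚ) * (C 2 : ℕ) := mul_le_mul_of_nonneg_right hq' (by positivity)
  have n3 : (0 : ℚ) ≤ (C 3 : ℕ) := by positivity
  have n4 : (0 : ℚ) ≤ (C 4 : ℕ) := by positivity
  nlinarith [e1, p1, p2, m0, m1, m2, m3, m4, m5, c0, n3, n4]

/-- **Corank `7` under the plane bound**: `0 ≤ J_3(G)` for `4 ≤ q`, `|G| = q + 7`, every plane of `G` with `≤ 4` points. -/
theorem Jq_three_nonneg_of_card_eq_add_seven_of_planes (hs : Simple M) {G : Finset α} {q : ℕ} (hG : G ⊆ gr M)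
    (hrG : M.eRk (G : Set α) = (q : ℕ∞)) (hq : 4 ≤ q)
    (hP : ∀ X ⊆ G, M.eRk (X : Set α) ≤ 3 → X.card ≤ 4) (hcard : G.card = q + 7) : 0 ≤ Jq M G q 3 := by
  apply Jq_three_nonneg_of_split hs hG hrG (by omega) hcard
  set C : ℕ → ℕ := fun j => ((Rq M G q).filter (fun S : Finset α => (G \ S).card = j)).card with hC
  have hd : G.card - q = 7 := by omega
  have hC0 : C 0 = 1 := card_filter_sdiff_eq_zero hrG
  have hle2 := card_three_le_card_filter_le_two (M := M) G q
  have l0 := succ_mul_card_ge_of_planes hs hG hrG hq hP (j := 0) (by omega)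
  have l1 := succ_mul_card_ge_of_planes hs hG hrG hq hP (j := 1) (by omega)
  have l2 := succ_mul_card_ge_of_planes hs hG hrG hq hP (j := 2) (by omega)
  have l3 := succ_mul_card_ge_of_planes hs hG hrG hq hP (j := 3) (by omega)
  have l4 := succ_mul_card_ge_of_planes hs hG hrG hq hP (j := 4) (by omega)
  have l5 := succ_mul_card_ge_of_planes hs hG hrG hq hP (j := 5) (by omega)
  have l6 := succ_mul_card_ge hs hG hrG (by omega) (j := 6) (by omega)
  rw [hd] at l0 l1 l2 l3 l4 l5 l6
  simp only [Finset.sum_range_succ, Finset.sum_range_zero]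
  push_cast
  have hq' : (4 : ℚ) ≤ (q : ℚ) := by exact_mod_cast hq
  have c0 : ((C 0 : ℕ) : ℚ) = 1 := by exact_mod_cast hC0
  have e2 : ((C 0 : ℕ) : ℚ) + (C 1 : ℕ) + (C 2 : ℕ) ≤
      ((((Rq M G q).filter (fun S : Finset α => (G \ S).card ≤ 2)).card : ℕ) : ℚ) := by exact_mod_cast hle2
  have m0 : (11 : ℚ) * (C 0 : ℕ) ≤ (C 1 : ℕ) := by
    have h' : 11 * C 0 ≤ C 1 := by
      simpa only [Nat.sub_zero, Nat.reduceAdd, Nat.zero_add, Nat.one_mul] using l0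
    exact_mod_cast h'
  have m1 : (10 : ℚ) * (C 1 : ℕ) ≤ 2 * (C 2 : ℕ) := by exact_mod_cast (by simpa using l1 : 10 * C 1 ≤ 2 * C 2)
  have m2 : (9 : ℚ) * (C 2 : ℕ) ≤ 3 * (C 3 : ℕ) := by exact_mod_cast (by simpa using l2 : 9 * C 2 ≤ 3 * C 3)
  have m3 : (8 : ℚ) * (C 3 : ℕ) ≤ 4 * (C 4 : ℕ) := by exact_mod_cast (by simpa using l3 : 8 * C 3 ≤ 4 * C 4)
  have m4 : (7 : ℚ) * (C 4 : ℕ) ≤ 5 * (C 5 : ℕ) := by exact_mod_cast (by simpa using l4 : 7 * C 4 ≤ 5 * C 5)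
  have m5 : (6 : ℚ) * (C 5 : ℕ) ≤ 6 * (C 6 : ℕ) := by exact_mod_cast (by simpa using l5 : 6 * C 5 ≤ 6 * C 6)
  have m6 : (3 : ℚ) * (C 6 : ℕ) ≤ 7 * (C 7 : ℕ) := by exact_mod_cast (by simpa using l6 : 3 * C 6 ≤ 7 * C 7)
  have hq2 : (0 : ℚ) ≤ (q : ℚ) + 2 := by positivity
  have e1 := mul_le_mul_of_nonneg_left e2 hq2
  have p1 : 4 * ((C 1 : ℕ) : ℚ) ≤ (q : ℚ) * (C 1 : ℕ) := mul_le_mul_of_nonneg_right hq' (by positivity)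
  have p2 : 4 * ((C 2 : ℕ) : ℚ) ≤ (q : ℚ) * (C 2 : ℕ) := mul_le_mul_of_nonneg_right hq' (by positivity)
  have n3 : (0 : ℚ) ≤ (C 3 : ℕ) := by positivity
  have n4 : (0 : ℚ) ≤ (C 4 : ℕ) := by positivity
  have n5 : (0 : ℚ) ≤ (C 5 : ℕ) := by positivity
  nlinarith [e1, p1, p2, m0, m1, m2, m3, m4, m5, m6, c0, n3, n4, n5]

end PercRepro.Star
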